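import Literature.AlgebraicGeometry.Resolution.Mulay1983WeierstrassShift
import Literature.AlgebraicGeometry.Resolution.RegularLocalRingsQuotient
import Literature.AlgebraicGeometry.Resolution.RegularLocalRingsNormal
import HarnessLib

/-!
# Smooth two-codimensional centres in `L⟦x₀, x_σ⟧`: Weierstrass normal form `(x₀ − θ, q)`, the
# evaluation `x₀ ↦ θ`, primality and rigidity (Mulay 1983, 3.1–3.5 for smooth centres)

Topic: `Literature/AlgebraicGeometry/Resolution`. Third brick of the discharge of the named fact
`Mulay1983_codimTwoHyperplanar` (`Mulay1983Hyperplanarity.lean`); S. B. Mulay, *Equimultiplicity and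
hyperplanarity*, Proc. Amer. Math. Soc. **89** (1983) 407–413 (lit key `paper:url-29aeafb0cf6c`).
With `R = L⟦x_{Option σ}⟧ ≅ S⟦T⟧`, `S = L⟦x_σ⟧` (the tree's `optionEquivLeft`, `T ↔ x_none`), Mulay's
table `(B, Z, A, d, f)` of §3 has `B = S`, and a height-two prime `P` of `A` containing a degree-one
element in `Z` satisfies «`P = (Z − θ)A + QA`» (3.1 (iii)) with `Q = P ∩ B`; for the SMOOTH centres of
the typed special case (ideals `(w, v)` generated by two regular parameters, `w` with linear part `x₀`)
we prove, with no new definitions: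

* `coeff` bookkeeping for `optionEquivLeft` (`constantCoeff_coeff_optionEquivLeft`,
  `coeff_single_coeff_zero_optionEquivLeft`, `coeff_optionEquivLeft_symm_C`) and the linear part of a
  product (`coeff_single_one_mul`);
* `exists_eval` — the `S`-algebra retraction `ev_θ : S⟦T⟧ → S`, `T ↦ θ` (`θ ∈ 𝔪_S`), with
  `(T − θ, C q) = ev_θ⁻¹ (q)` (Mulay's triode epimorphism `u : R → S`, §2, and 3.1 (iii));
* `exists_normalForm` — a smooth centre `(w, v) ⊆ R` maps under `optionEquivLeft` to `(T − θ, C q)` with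
  `θ ∈ 𝔪_S` and `q` a REGULAR PARAMETER of `S` (`q ∈ 𝔪_S ∖ 𝔪_S²`);
* `prime_of_coeff_single_ne_zero` — a regular parameter of `S = L⟦x_σ⟧` is a prime element
  (Matsumura 14.2 via the tree's `IsRegularLocalRing.quotient_span_singleton`);
* `span_X_sub_C_eq_of_associated` and `span_X_sub_C_eq_of_le` — RIGIDITY: `(T − θ, q) = (T − θ', q')`
  as soon as `q ~ q'` and `θ ≡ θ' (mod q)`, and two such primes that are comparable are equal
  (Mulay 3.5: «If `Q₁ ⊂ Q₂` then `P₁ ⊂ P₂`», here for smooth centres).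

No statement of H. Hironaka's 2017 manuscript is involved. AI formalisation; weaker than expert
review.

## References
* S. B. Mulay, *Equimultiplicity and hyperplanarity*, Proc. Amer. Math. Soc. 89 (1983) 407–413,
  §2 (triodes), 3.1 (iii), 3.4 (i), 3.5. [Mulay1983]
* H. Matsumura, *Commutative Ring Theory*, CUP 1986, Thm. 14.2. [Matsumura1987]
-/

noncomputable section

namespace Literature.AlgebraicGeometry.Resolution

namespace Mulay1983

open IsLocalRing Polynomial Literature.RingTheory.MvPowerSeries

universe u v

variable {L : Type u} [Field L] {σ : Type v}

/-! ## 1. Coefficient bookkeeping for `optionEquivLeft` -/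

section Coeff

/-- `(0 : σ →₀ ℕ).optionElim m = single none m`. [folklore] -/
private theorem optionElim_zero (m : ℕ) : (0 : σ →₀ ℕ).optionElim m = Finsupp.single none m := by
  ext o
  cases o with
  | none => simp
  | some s => simp

/-- `(single s 1).optionElim 0 = single (some s) 1`. [folklore] -/
private theorem optionElim_single (s : σ) :
    (Finsupp.single s 1 : σ →₀ ℕ).optionElim 0 = Finsupp.single (some s) 1 := by
  classical
  ext o
  cases o with
  | none => simp
  | some t =>
    rw [Finsupp.optionElim_apply_some, Finsupp.single_apply, Finsupp.single_apply]
    simp only [Option.some.injEq]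

/-- The `S`-constant term of `[T^m](optionEquivLeft h)` is the coefficient of `x_none^m` in `h`
(Mulay's `B`-coefficients `b(i)` of §3, read off the split variable). [cite: Mulay1983, §3 (tables), p. 410] -/
theorem constantCoeff_coeff_optionEquivLeft (h : MvPowerSeries (Option σ) L) (m : ℕ) :
    MvPowerSeries.constantCoeff (PowerSeries.coeff m (optionEquivLeft h)) =
      MvPowerSeries.coeff (Finsupp.single none m) h := by
  rw [← MvPowerSeries.coeff_zero_eq_constantCoeff_apply, coeff_coeff_optionEquivLeft, optionElim_zero]

/-- The `x_s`-linear coefficient of `[T⁰](optionEquivLeft h)` is the `x_{some s}`-linear coefficient of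
`h`. [cite: Mulay1983, §3 (tables), p. 410] -/
theorem coeff_single_coeff_zero_optionEquivLeft (h : MvPowerSeries (Option σ) L) (s : σ) :
    MvPowerSeries.coeff (Finsupp.single s 1) (PowerSeries.coeff 0 (optionEquivLeft h)) =
      MvPowerSeries.coeff (Finsupp.single (some s) 1) h := by
  rw [coeff_coeff_optionEquivLeft, optionElim_single]

/-- Coefficients of the series `optionEquivLeft⁻¹ (C p)` in the variables `x_{some s}`: those of `p`
at exponents with no `x_none`, zero otherwise. [cite: Mulay1983, §3 (tables), p. 410] -/
theorem coeff_optionEquivLeft_symm_C (p : MvPowerSeries σ L) (e : Option σ →₀ ℕ) :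
    MvPowerSeries.coeff e ((optionEquivLeft (σ := σ) (R := L)).symm (PowerSeries.C p)) =
      if e none = 0 then MvPowerSeries.coeff e.some p else 0 := by
  rw [coeff_optionEquivLeft_symm, PowerSeries.coeff_C]
  split_ifs with h
  · rfl
  · rw [MvPowerSeries.coeff_zero]

/-- **Linear part of a product**: `[x_o](r·a) = r(0)·[x_o]a + [x_o]r·a(0)`. [folklore] -/
private theorem coeff_single_one_mul {τ : Type v} (o : τ) (r a : MvPowerSeries τ L) :
    MvPowerSeries.coeff (Finsupp.single o 1) (r * a) =
      MvPowerSeries.constantCoeff r * MvPowerSeries.coeff (Finsupp.single o 1) a +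
        MvPowerSeries.coeff (Finsupp.single o 1) r * MvPowerSeries.constantCoeff a := by
  classical
  rw [MvPowerSeries.coeff_mul, Finsupp.antidiagonal_single, Finset.sum_map, Finset.Nat.antidiagonal_succ,
    Finset.sum_cons, Finset.Nat.antidiagonal_zero, Finset.map_singleton, Finset.sum_singleton]
  simp only [Function.Embedding.coe_prodMap, Function.Embedding.coeFn_mk, Prod.map_apply,
    Function.Embedding.refl_apply, Finsupp.single_zero, MvPowerSeries.coeff_zero_eq_constantCoeff_apply]

/-- Linear parts of elements of an ideal `(a, b)` with `a, b ∈ 𝔪` are combinations of the linear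
parts of `a` and `b` with constant coefficients. [folklore] -/
private theorem exists_coeff_single_eq_of_mem_span_pair {τ : Type v} {a b h : MvPowerSeries τ L}
    (ha : MvPowerSeries.constantCoeff a = 0) (hb : MvPowerSeries.constantCoeff b = 0)
    (hh : h ∈ Ideal.span {a, b}) :
    ∃ c₁ c₂ : L, ∀ o : τ, MvPowerSeries.coeff (Finsupp.single o 1) h =
      c₁ * MvPowerSeries.coeff (Finsupp.single o 1) a + c₂ * MvPowerSeries.coeff (Finsupp.single o 1) b := by
  obtain ⟨r, r', rfl⟩ := Ideal.mem_span_pair.mp hh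
  refine ⟨MvPowerSeries.constantCoeff r, MvPowerSeries.constantCoeff r', fun o => ?_⟩
  rw [map_add, coeff_single_one_mul, coeff_single_one_mul, ha, hb, mul_zero, add_zero, mul_zero, add_zero]

end Coeff

/-! ## 2. The evaluation `T ↦ θ` and the primes `(T − θ, q)` -/

section Eval

variable [Finite σ]

/-- **The retraction `ev_θ : S⟦T⟧ → S`, `T ↦ θ`** (`θ ∈ 𝔪_S`, `S = L⟦x_σ⟧`): a ring homomorphism with
`ev T = θ`, `ev (C p) = p`, and for every `q ∈ S` the ideal `(T − C θ, C q)` is `ev⁻¹((q))`. (This is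
Mulay's epimorphism `u : R → S` with `ker u = zR` of a triode `(R, S, z)`, §2, for `z = T − θ`, and his
3.1 (iii) «`P = (Z − θ)A + QA`».) [cite: Mulay1983, §2 (triodes) and 3.1 (iii), pp. 409–410] -/
theorem exists_eval (θ : MvPowerSeries σ L) (hθ : MvPowerSeries.constantCoeff θ = 0) :
    ∃ ev : PowerSeries (MvPowerSeries σ L) →+* MvPowerSeries σ L,
      ev PowerSeries.X = θ ∧ (∀ p, ev (PowerSeries.C p) = p) ∧
        ∀ q : MvPowerSeries σ L,
          Ideal.span {PowerSeries.X - PowerSeries.C θ, PowerSeries.C q} = (Ideal.span {q}).comap ev := by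
  obtain ⟨sh, hX, hC⟩ := exists_shift θ hθ
  let ev : PowerSeries (MvPowerSeries σ L) →+* MvPowerSeries σ L :=
    (PowerSeries.constantCoeff (R := MvPowerSeries σ L)).comp sh.toRingHom
  have hev : ∀ h, ev h = PowerSeries.constantCoeff (sh h) := fun h => rfl
  have hevX : ev PowerSeries.X = θ := by
    rw [hev, hX, map_add, PowerSeries.constantCoeff_X, PowerSeries.constantCoeff_C, zero_add]
  have hevC : ∀ p, ev (PowerSeries.C p) = p := fun p => by
    rw [hev, hC, PowerSeries.constantCoeff_C]
  -- the kernel of `ev` is `(T − C θ)`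
  have hker : ∀ h, ev h = 0 → h ∈ Ideal.span {PowerSeries.X - PowerSeries.C θ} := by
    intro h h0
    rw [hev, ← PowerSeries.X_dvd_iff] at h0
    obtain ⟨r, hr⟩ := h0
    have : h = sh.symm PowerSeries.X * sh.symm r := by
      rw [← map_mul, ← hr, RingEquiv.symm_apply_apply]
    rw [this]
    refine Ideal.mul_mem_right _ _ (Ideal.mem_span_singleton'.mpr ⟨1, ?_⟩)
    rw [one_mul]
    apply sh.injective
    rw [RingEquiv.apply_symm_apply, map_sub, hX, hC, add_sub_cancel_right]
  refine ⟨ev, hevX, hevC, fun q => le_antisymm ?_ ?_⟩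
  · rw [Ideal.span_le]
    rintro h hh
    simp only [Set.mem_insert_iff, Set.mem_singleton_iff] at hh
    rcases hh with rfl | rfl
    · rw [SetLike.mem_coe, Ideal.mem_comap, map_sub, hevX, hevC, sub_self]; exact Ideal.zero_mem _
    · rw [SetLike.mem_coe, Ideal.mem_comap, hevC]; exact Ideal.mem_span_singleton_self q
  · intro h hh
    rw [Ideal.mem_comap, Ideal.mem_span_singleton] at hh
    obtain ⟨t, ht⟩ := hh
    have hsplit : h = (h - PowerSeries.C (ev h)) + PowerSeries.C q * PowerSeries.C t := by
      rw [ht, map_mul]; ring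
    rw [hsplit]
    refine Ideal.add_mem _ ?_ (Ideal.mul_mem_right _ _ (Ideal.subset_span (by simp)))
    have h0 : ev (h - PowerSeries.C (ev h)) = 0 := by rw [map_sub, hevC, sub_self]
    exact Ideal.span_mono (by simp) (hker _ h0)

end Eval

/-! ## 3. Regular parameters of `L⟦x_σ⟧` are prime -/

section RegularParameter

variable [Finite σ]

/-- A **regular parameter** of `S = L⟦x_σ⟧` (zero constant term, some non-zero linear coefficient) is a
prime element: `S/(q)` is a regular local ring (Matsumura 14.2, the tree's
`IsRegularLocalRing.quotient_span_singleton`), hence a domain. (Mulay 3.9: «`x` is a regular parameter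
of `R` and hence `R/xR` is a regular local domain».) [cite: Mulay1983, 3.9 p. 412] -/
theorem prime_of_coeff_single_ne_zero {q : MvPowerSeries σ L} (hq0 : MvPowerSeries.constantCoeff q = 0)
    {s : σ} (hqs : MvPowerSeries.coeff (Finsupp.single s 1) q ≠ 0) : Prime q := by
  haveI : IsRegularLocalRing (MvPowerSeries σ L) := isRegularLocalRing_mvPowerSeries L σ
  have hqm : q ∈ maximalIdeal (MvPowerSeries σ L) :=
    Jets.mem_maximalIdeal_iff_constantCoeff_eq_zero.mpr hq0
  have hqm2 : q ∉ maximalIdeal (MvPowerSeries σ L) ^ 2 := fun h =>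
    hqs (Jets.coeff_eq_zero_of_mem_maximalIdeal_pow h (by simp))
  haveI hreg := (IsRegularLocalRing.quotient_span_singleton hqm hqm2).1
  haveI := isDomain_of_isRegularLocalRing (MvPowerSeries σ L ⧸ Ideal.span {q})
  have hne : q ≠ 0 := fun h => hqs (by rw [h, map_zero])
  exact (Ideal.span_singleton_prime hne).mp ((Ideal.Quotient.isDomain_iff_prime _).mp ‹_›)

end RegularParameter

/-! ## 4. Normal form of a smooth centre -/

section NormalForm

variable [Finite σ]

/-- **Weierstrass normal form of a smooth two-codimensional centre.** Let `w, v ∈ R = L⟦x_{Option σ}⟧`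
have zero constant terms, with the linear part of `w` equal to `x_none` and the linear part of `v` not a
multiple of it (some `x_{some s}`-coefficient of `v` is non-zero). Then under `optionEquivLeft` the ideal
`(w, v)` becomes `(T − C θ, C q)` with `θ ∈ 𝔪_S` and `q` a REGULAR PARAMETER of `S = L⟦x_σ⟧`
(Mulay 3.1 (iii) «`P = (Z − θ)A + QA`» with 2.4, for smooth centres; `Q = (q)` is then a height-one
prime with regular quotient). [cite: Mulay1983, 2.4 and 3.1 (iii), pp. 409–410] -/
theorem exists_normalForm (w v : MvPowerSeries (Option σ) L)
    (hw0 : MvPowerSeries.constantCoeff w = 0)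
    (hw1 : MvPowerSeries.coeff (Finsupp.single none 1) w = 1)
    (hws : ∀ s : σ, MvPowerSeries.coeff (Finsupp.single (some s) 1) w = 0)
    (hv0 : MvPowerSeries.constantCoeff v = 0)
    (hvs : ∃ s : σ, MvPowerSeries.coeff (Finsupp.single (some s) 1) v ≠ 0) :
    ∃ θ q : MvPowerSeries σ L, MvPowerSeries.constantCoeff θ = 0 ∧ MvPowerSeries.constantCoeff q = 0 ∧
      (∃ s : σ, MvPowerSeries.coeff (Finsupp.single s 1) q ≠ 0) ∧
        (Ideal.span {w, v}).map (optionEquivLeft (σ := σ) (R := L)).toRingHom =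
          Ideal.span {PowerSeries.X - PowerSeries.C θ, PowerSeries.C q} := by
  classical
  set E : MvPowerSeries (Option σ) L ≃+* PowerSeries (MvPowerSeries σ L) := optionEquivLeft with hE
  -- the hypotheses of the Weierstrass normal form for `E w`
  have hEw0 : MvPowerSeries.constantCoeff (PowerSeries.coeff 0 (E w)) = 0 := by
    rw [hE, constantCoeff_coeff_optionEquivLeft, Finsupp.single_zero, MvPowerSeries.coeff_zero_eq_constantCoeff_apply, hw0]
  have hEw1 : IsUnit (PowerSeries.coeff 1 (E w)) := by
    rw [MvPowerSeries.isUnit_iff_constantCoeff, hE, constantCoeff_coeff_optionEquivLeft, hw1]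
    exact isUnit_one
  obtain ⟨θ, q, hθ, hspan⟩ := exists_span_pair_eq_span_X_sub_C (E w) (E v) hEw0 hEw1
  have hmap : (Ideal.span {w, v}).map E.toRingHom = Ideal.span {PowerSeries.X - PowerSeries.C θ, PowerSeries.C q} := by
    rw [Ideal.map_span, Set.image_pair]; exact hspan
  -- pull back: `(w, v) = (x_none − ιθ, ιq)` in `R`
  have hback : Ideal.span {w, v} =
      Ideal.span {E.symm (PowerSeries.X - PowerSeries.C θ), E.symm (PowerSeries.C q)} := by
    have := congrArg (Ideal.map E.symm.toRingHom) hmap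
    rw [Ideal.map_map, Ideal.map_span E.symm.toRingHom, Set.image_pair] at this
    simpa [Ideal.map_id] using this
  have hEsymmX : E.symm PowerSeries.X = MvPowerSeries.X none := by
    rw [hE, ← optionEquivLeft_X_none, RingEquiv.symm_apply_apply]
  -- constant terms
  have hq0 : MvPowerSeries.constantCoeff q = 0 := by
    have hmem : E.symm (PowerSeries.C q) ∈ Ideal.span {w, v} := by
      rw [hback]; exact Ideal.subset_span (by simp)
    obtain ⟨r, r', hr⟩ := Ideal.mem_span_pair.mp hmem
    have := congrArg MvPowerSeries.constantCoeff hr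
    rw [map_add, map_mul, map_mul, hw0, hv0, mul_zero, mul_zero, add_zero] at this
    rw [← MvPowerSeries.coeff_zero_eq_constantCoeff_apply, hE, coeff_optionEquivLeft_symm_C] at this
    simpa using this.symm
  -- linear parts: `w` and `v` against the generators `x_none − ιθ`, `ιq`
  have hlinA : ∀ o, MvPowerSeries.coeff (Finsupp.single o 1) (E.symm (PowerSeries.X - PowerSeries.C θ)) =
      (if o = none then (1 : L) else 0) - (o.elim 0 fun s => MvPowerSeries.coeff (Finsupp.single s 1) θ) := by
    intro o
    rw [map_sub, hEsymmX, map_sub, MvPowerSeries.coeff_X, hE, coeff_optionEquivLeft_symm_C]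
    cases o with
    | none => simp
    | some s =>
      have h1 : (Finsupp.single (some s) 1 : Option σ →₀ ℕ) ≠ Finsupp.single none 1 := by
        intro h; have := (Finsupp.single_eq_single_iff _ _ _ _).mp h; simp at this
      have h2 : (Finsupp.single (some s) 1 : Option σ →₀ ℕ) none = 0 := by simp
      have h3 : (Finsupp.single (some s) 1 : Option σ →₀ ℕ).some = Finsupp.single s 1 := by
        ext t; simp [Finsupp.single_apply]
      simp [h1, h2, h3]
  have hlinB : ∀ o, MvPowerSeries.coeff (Finsupp.single o 1) (E.symm (PowerSeries.C q)) =
      o.elim 0 fun s => MvPowerSeries.coeff (Finsupp.single s 1) q := by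
    intro o
    rw [hE, coeff_optionEquivLeft_symm_C]
    cases o with
    | none => simp
    | some s =>
      have h2 : (Finsupp.single (some s) 1 : Option σ →₀ ℕ) none = 0 := by simp
      have h3 : (Finsupp.single (some s) 1 : Option σ →₀ ℕ).some = Finsupp.single s 1 := by
        ext t; simp [Finsupp.single_apply]
      simp [h2, h3]
  have hA0 : MvPowerSeries.constantCoeff (E.symm (PowerSeries.X - PowerSeries.C θ)) = 0 := by
    rw [map_sub, hEsymmX, map_sub, MvPowerSeries.constantCoeff_X, ← MvPowerSeries.coeff_zero_eq_constantCoeff_apply,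
      hE, coeff_optionEquivLeft_symm_C]
    simp [hθ]
  have hB0 : MvPowerSeries.constantCoeff (E.symm (PowerSeries.C q)) = 0 := by
    rw [← MvPowerSeries.coeff_zero_eq_constantCoeff_apply, hE, coeff_optionEquivLeft_symm_C]; simp [hq0]
  have hqlin : ∃ s : σ, MvPowerSeries.coeff (Finsupp.single s 1) q ≠ 0 := by
    by_contra hnone
    push Not at hnone
    -- `w`: `1 = c₁`, `0 = −c₁ θ_s + c₂ q_s = −c₁ θ_s`
    have hwmem : w ∈ Ideal.span {E.symm (PowerSeries.X - PowerSeries.C θ), E.symm (PowerSeries.C q)} := by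
      rw [← hback]; exact Ideal.subset_span (by simp)
    obtain ⟨c₁, c₂, hc⟩ := exists_coeff_single_eq_of_mem_span_pair hA0 hB0 hwmem
    have hc1 : c₁ = 1 := by
      have := hc none
      rw [hw1, hlinA, hlinB] at this
      simpa using this.symm
    have hθlin : ∀ s, MvPowerSeries.coeff (Finsupp.single s 1) θ = 0 := by
      intro s
      have := hc (some s)
      rw [hws, hlinA, hlinB, hc1] at this
      simpa [hnone s] using this
    -- `v`: `v_s = −d₁ θ_s + d₂ q_s = 0`, contradiction
    have hvmem : v ∈ Ideal.span {E.symm (PowerSeries.X - PowerSeries.C θ), E.symm (PowerSeries.C q)} := by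
      rw [← hback]; exact Ideal.subset_span (by simp)
    obtain ⟨d₁, d₂, hd⟩ := exists_coeff_single_eq_of_mem_span_pair hA0 hB0 hvmem
    obtain ⟨s, hs⟩ := hvs
    apply hs
    rw [hd (some s), hlinA, hlinB]
    simp [hθlin s, hnone s]
  exact ⟨θ, q, hθ, hq0, hqlin, hmap⟩

end NormalForm

/-! ## 5. Rigidity of the primes `(T − θ, q)` -/

section Rigidity

variable {S : Type u} [CommRing S]

/-- If `q ~ q'` and `q ∣ θ − θ'` then `(T − C θ, C q) = (T − C θ', C q')` in `S⟦T⟧`. [cite: Mulay1983, 3.5 p. 411] -/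
theorem span_X_sub_C_eq_of_associated {θ θ' q q' : S} (hqq : Associated q q') (hθ : q ∣ θ - θ') :
    Ideal.span {PowerSeries.X - PowerSeries.C θ, PowerSeries.C q} =
      Ideal.span ({PowerSeries.X - PowerSeries.C θ', PowerSeries.C q'} : Set (PowerSeries S)) := by
  -- symmetric statement; prove `≤` for both orientations
  have key : ∀ {a a' b b' : S}, Associated b b' → b ∣ a - a' →
      Ideal.span ({PowerSeries.X - PowerSeries.C a', PowerSeries.C b'} : Set (PowerSeries S)) ≤
        Ideal.span {PowerSeries.X - PowerSeries.C a, PowerSeries.C b} := by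
    intro a a' b b' hbb hba
    rw [Ideal.span_le]
    rintro x hx
    simp only [Set.mem_insert_iff, Set.mem_singleton_iff] at hx
    obtain ⟨t, ht⟩ := hba
    obtain ⟨u, hu⟩ := hbb
    rcases hx with rfl | rfl
    · -- `X − C a' = (X − C a) + C (a − a') = (X − C a) + C t · C b`
      have : PowerSeries.X - PowerSeries.C a' =
          (PowerSeries.X - PowerSeries.C a) + PowerSeries.C t * PowerSeries.C b := by
        rw [← map_mul, mul_comm, ← ht, map_sub]; ring
      rw [SetLike.mem_coe, this]
      exact Ideal.add_mem _ (Ideal.subset_span (by simp)) (Ideal.mul_mem_left _ _ (Ideal.subset_span (by simp)))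
    · have : PowerSeries.C b' = PowerSeries.C (↑u : S) * PowerSeries.C b := by rw [← map_mul, mul_comm, hu]
      rw [SetLike.mem_coe, this]
      exact Ideal.mul_mem_left _ _ (Ideal.subset_span (by simp))
  refine le_antisymm ?_ (key hqq hθ)
  refine key hqq.symm ?_
  obtain ⟨u, hu⟩ := hqq
  rw [← hu]
  exact dvd_sub_comm.mp (Units.mul_right_dvd.mpr hθ)

/-- **Rigidity / antichain**: over `S = L⟦x_σ⟧`, if `θ, θ' ∈ 𝔪_S`, `q, q'` are prime elements, and
`(T − θ, q) ⊆ (T − θ', q')`, then the two ideals are equal (Mulay 3.5 for smooth centres: the prime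
`Q = (q)` under `P` determines `P`). [cite: Mulay1983, 3.5 p. 411] -/
theorem span_X_sub_C_eq_of_le {L : Type u} [Field L] {σ : Type v} [Finite σ]
    {θ θ' q q' : MvPowerSeries σ L} (hθ' : MvPowerSeries.constantCoeff θ' = 0)
    (hq : Prime q) (hq' : Prime q')
    (hle : Ideal.span {PowerSeries.X - PowerSeries.C θ, PowerSeries.C q} ≤
      Ideal.span ({PowerSeries.X - PowerSeries.C θ', PowerSeries.C q'} : Set (PowerSeries (MvPowerSeries σ L)))) :
    Ideal.span {PowerSeries.X - PowerSeries.C θ, PowerSeries.C q} =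
      Ideal.span ({PowerSeries.X - PowerSeries.C θ', PowerSeries.C q'} : Set (PowerSeries (MvPowerSeries σ L))) := by
  obtain ⟨ev, hevX, hevC, hcomap⟩ := exists_eval θ' hθ'
  have hq_mem : q ∈ Ideal.span {q'} := by
    have : PowerSeries.C q ∈ (Ideal.span {q'}).comap ev := by
      rw [← hcomap]; exact hle (Ideal.subset_span (by simp))
    rw [Ideal.mem_comap, hevC] at this; exact this
  have hθ_mem : θ' - θ ∈ Ideal.span {q'} := by
    have : PowerSeries.X - PowerSeries.C θ ∈ (Ideal.span {q'}).comap ev := by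
      rw [← hcomap]; exact hle (Ideal.subset_span (by simp))
    rw [Ideal.mem_comap, map_sub, hevX, hevC] at this; exact this
  have hass : Associated q' q :=
    (hq'.irreducible.dvd_irreducible_iff_associated hq.irreducible).mp (Ideal.mem_span_singleton.mp hq_mem)
  exact (span_X_sub_C_eq_of_associated hass (Ideal.mem_span_singleton.mp hθ_mem)).symm

end Rigidity

end Mulay1983

end Literature.AlgebraicGeometry.Resolution
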